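import Literature.ComputerArithmetic.Shewchuk1997.Compress
import Mathlib.Tactic.Linarith
import Mathlib.Tactic.Positivity
import Mathlib.Tactic.Ring
import Mathlib.Tactic.NormNum

/-!
# COMPRESS, first traversal: the stair is SHARP under powers of two (new work)

New work of the certified-arithmetic venture (ENGINES group: shared numerical engines serving
client cells; rigour lives in the verifiers; every published number belongs to a client cell's
ledger, not to the engines group), part 1 of 3 of the proof of the sharp error bound for the largest
component of Shewchuk's COMPRESS [Shewchuk1997, §2.7, Theorem 23 and the conjecture on p. 333]
(part 2 `CompressCarryBound.lean`, part 3 `CompressTopError.lean`), over the tree's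
formalisation `Literature/ComputerArithmetic/Shewchuk1997/Compress.lean` (`compressDown`,
`compressDown_spec`, `DownOut`).

THE FIRST TRAVERSAL of COMPRESS (Theorem 23, Lines 1–9) turns a nonoverlapping expansion into
components `g_top, …, g_1, g_bottom` (largest first) in which everything below a component `g`
sums to less than `ulp(g)` in magnitude (the tree's `DownOut.stair`; the paper's "the sum of the
components that are smaller than gᵢ is smaller than gᵢ", p. 333).  THIS FILE proves that the
stair is SHARP UNDER POWERS OF TWO (`compressDown_sharp_stair`): when `|g| = 2^j` is a power of two
(`j ≥ emin + p`) and the sum of the components below `g` points from `g` TOWARDS ZERO, that sum is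
even below `ulp(g)/2`.  Reason: `g = fl(Q + x)` comes out of a FAST-TWO-SUM whose roundoff `q` is
then nonzero and carries the sign of the whole lower sum (the inputs not yet visited lie below a
common quantum `2^s ≤ |q|` and sum to less than `2^s`); so `Q + x = g + q` lies on the zero side of
`g`: `g` was rounded AWAY from zero onto the power of two, from the binade below it, where floats
are twice as dense — whence `|q| ≤ ulp(g)/4` (`roundoff_quarter`) and
`|q + Σ(rest)| < 2|q| ≤ ulp(g)/2`.  In general only `< ulp(g)` holds (a tie `|q| = ulp(g)/2`
followed by inputs summing to nearly `|q|`), so the sharpening is genuinely conditional.  The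
statement is addressed by splitting the output `gs ++ [g_bottom] = pre ++ g :: post` of
`compressDown`.

References: J. R. Shewchuk, Adaptive precision floating-point arithmetic and fast robust geometric
predicates, Discrete Comput. Geom. 18 (1997) 305–363, §2.7 [Shewchuk1997]; ulp, roundings and
FAST-TWO-SUM as in S. Boldo, C.-P. Jeannerod, G. Melquiond, J.-M. Muller, Floating-point arithmetic,
ACM Comput. Surv. 55 (2023), §2 [BoldoEtAl2023].
-/

namespace Summit.Ventures.CertifiedArithmetic.Expansions

open Literature.ComputerArithmetic.JeannerodRump2018
open Literature.ComputerArithmetic.BoldoJeannerodMelquiondMuller2023 hiding twoSum twoSum_fst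
open Literature.ComputerArithmetic.JoldesMullerPopescu2017 (ulp_le_of_abs_lt_two_zpow)
open Literature.ComputerArithmetic.GraillatMuller2025 (ulp_two_zpow)
open Literature.ComputerArithmetic.Shewchuk1997

variable {p : ℕ} {emin : ℤ} {fl : ℚ → ℚ}

/-- A round-to-nearest error is at most `ulp(fl t)/4` when `|fl t| = 2^j` (`j ≥ emin + p`) is a
power of two approached from below (`|t| < |fl t|`): `t` then lies in the binade below `2^j`,
whose ulp is `ulp(fl t)/2`. [cite: BoldoEtAl2023, §2.6 Property 2.7 (consequence)] -/
private theorem roundoff_quarter (hp : 1 ≤ p) (hfl : IsRoundNearest p emin fl) (t : ℚ) {j : ℤ}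
    (hj : emin + p ≤ j) (hpow : |fl t| = 2 ^ j) (hlt : |t| < |fl t|) :
    |t - fl t| ≤ ulp p emin (fl t) / 4 := by
  have hE : emin ≤ j - p + 1 := by omega
  have hut : ulp p emin t ≤ (2 : ℚ) ^ (j - p) :=
    ulp_le_of_abs_lt_two_zpow (by rw [← hpow]; exact hlt) (by omega)
  have huf : ulp p emin (fl t) = 2 * (2 : ℚ) ^ (j - p) := by
    rw [← ulp_abs, hpow, ulp_two_zpow hE, show j - p + 1 = (j - p) + 1 by ring,
      zpow_add_one₀ (by norm_num : (2 : ℚ) ≠ 0), mul_comm]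
  have := abs_sub_fl_le_half_ulp hp hfl t
  rw [huf]; linarith

/-! ### The first traversal leaves a SHARP stair under every power of two -/

/-- THE SHARP STAIR.  Theorem 23's first traversal (Lines 1–9) leaves components
`g_m, …, g_1, g_bottom` (largest first) in which everything below a component `g` sums to less
than `ulp g` (`DownOut.stair`).  When `|g| = 2^j` is a power of two (`j ≥ emin + p`) and that lower
sum points from `g` TOWARDS ZERO, it is even below `ulp(g)/2`: `g = fl(Q + x)` was then rounded
AWAY from zero onto the power of two, so its roundoff is at most a quarter ulp, and the input
components not yet visited sum to less than the roundoff. -/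
theorem compressDown_sharp_stair (hp : 2 ≤ p) (hfl : IsRoundNearest p emin fl) :
    ∀ (xs : List ℚ) (Q : ℚ), IsFloat p emin Q → (∀ y ∈ xs, IsFloat p emin y) →
      IsExpansion 1 xs.reverse → (∀ y ∈ xs, Below 1 y Q) →
      ∀ (pre post : List ℚ) (g : ℚ),
        (compressDown fl Q xs).1 ++ [(compressDown fl Q xs).2] = pre ++ g :: post →
        (∃ j : ℤ, emin + p ≤ j ∧ |g| = 2 ^ j) → g * post.sum < 0 →
        |post.sum| < ulp p emin g / 2 := by
  have hp1 : 1 ≤ p := le_trans (by norm_num) hp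
  intro xs
  induction xs with
  | nil =>
    intro Q _ _ _ _ pre post g hsplit _ hsgn
    -- the output is `[Q]`: nothing lies below it
    exfalso
    have hpost : post = [] := by
      cases pre with
      | nil =>
        have h : Q = g ∧ [] = post := by simpa using hsplit
        exact h.2.symm
      | cons a pre' =>
        have h := congrArg List.length hsplit
        simp only [compressDown_nil, List.nil_append, List.cons_append, List.length_cons,
          List.length_append, List.length_nil] at h
        omega
    subst hpost
    simp at hsgn
  | cons x xs ih =>
    intro Q hQ hF hexp hbel pre post g hsplit hpow hsgn
    have hx : IsFloat p emin x := hF x (by simp)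
    have hxsF : ∀ y ∈ xs, IsFloat p emin y := fun y hy => hF y (List.mem_cons_of_mem _ hy)
    rw [List.reverse_cons] at hexp
    have hexp' : IsExpansion 1 xs.reverse := hexp.sublist (List.sublist_append_left _ _)
    have hbelx : ∀ y ∈ xs, Below 1 y x := fun y hy =>
      (List.pairwise_append.mp hexp).2.2 y (List.mem_reverse.mpr hy) x (by simp)
    have hxQ : Below 1 x Q := hbel x (by simp)
    have hbel' : ∀ y ∈ xs, Below 1 y Q := fun y hy => hbel y (List.mem_cons_of_mem _ hy)
    by_cases hQ0 : Q = 0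
    · have hF0 : fastTwoSum fl Q x = (x, 0) := by rw [hQ0]; exact fastTwoSum_zero_left hfl hx
      have hq : (fastTwoSum fl Q x).2 = 0 := by rw [hF0]
      rw [compressDown_cons_of_eq_zero hq, hF0] at hsplit
      exact ih x hx hxsF hexp' hbelx pre post g hsplit hpow hsgn
    · have hxQ' : |x| ≤ |Q| := (hxQ.abs_lt le_rfl hQ0).le
      obtain ⟨h1, -, h2, h4⟩ := fastTwoSum_exact hp1 hfl hQ hx hxQ'
      have hF12 := isFloat_fastTwoSum hfl Q x
      by_cases hq : (fastTwoSum fl Q x).2 = 0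
      · -- exact step: the carry becomes `Q + x`
        rw [compressDown_cons_of_eq_zero hq] at hsplit
        generalize hQn : (fastTwoSum fl Q x).1 = Qn at *
        have hQnval : Qn = Q + x := by rw [hq, add_zero] at h4; exact h4
        have hbelQn : ∀ y ∈ xs, Below 1 y Qn := by
          intro y hy
          obtain ⟨s, -, hsQ, hsx, hys⟩ := exists_grid_below_pair hQ hx (hbel' y hy) (hbelx y hy)
          exact ⟨s, by rw [hQnval]; exact hsQ.add hsx, by rwa [one_mul]⟩
        exact ih Qn hF12.1 hxsF hexp' hbelQn pre post g hsplit hpow hsgn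
      · -- emitting step: `Qn` is emitted above everything produced from the carry `q`
        rw [compressDown_cons_of_ne_zero hq] at hsplit
        generalize hQn : (fastTwoSum fl Q x).1 = Qn at *
        generalize hqn : (fastTwoSum fl Q x).2 = q at *
        have hbelq : ∀ y ∈ xs, Below 1 y q := by
          intro y hy
          obtain ⟨s, hs, hsQ, hsx, hys⟩ := exists_grid_below_pair hQ hx (hbel' y hy) (hbelx y hy)
          have hst : OnGrid s (Q + x) := hsQ.add hsx
          exact ⟨s, by rw [h2]; exact hst.sub (hst.fl_of hp1 hfl hs), by rwa [one_mul]⟩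
        have hsplit' : Qn :: ((compressDown fl q xs).1 ++ [(compressDown fl q xs).2]) =
            pre ++ g :: post := by simpa using hsplit
        cases pre with
        | cons a pre' =>
          have htl : (compressDown fl q xs).1 ++ [(compressDown fl q xs).2] = pre' ++ g :: post :=
            (List.cons_eq_cons.mp (by simpa using hsplit')).2
          exact ih q hF12.2 hxsF hexp' hbelq pre' post g htl hpow hsgn
        | nil =>
          obtain ⟨hgQn, hpost⟩ := List.cons_eq_cons.mp (by simpa using hsplit')
          -- `g = Qn` and `post` = everything the sweep makes out of the carry `q` and `xs`
          subst hgQn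
          have out := compressDown_spec hp hfl xs q hF12.2 hxsF hexp' hbelq
          have hps : post.sum = q + xs.sum := by
            rw [← hpost, List.sum_append, List.sum_singleton]; exact out.sum_eq
          rw [hps] at hsgn ⊢
          -- a common quantum below `Q` and `x` and above all of `xs`
          obtain ⟨s, hs, hsQ, hsx, hall⟩ :=
            exists_grid_below_list hQ hx (fun y hy => ⟨hbel' y hy, hbelx y hy⟩)
          have hst : OnGrid s (Q + x) := hsQ.add hsx
          have hsq : OnGrid s q := by rw [h2]; exact hst.sub (hst.fl_of hp1 hfl hs)
          have h2s_le_q : (2 : ℚ) ^ s ≤ |q| := hsq.two_zpow_le_abs hq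
          have hxs_sum : |xs.sum| < (2 : ℚ) ^ s := abs_sum_lt_two_zpow_of_rev hxsF hexp' hall
          have hq_half : |q| ≤ ulp p emin Qn / 2 := by
            rw [h2, h1]; exact abs_sub_fl_le_half_ulp_fl hp1 hfl (Q + x)
          have hQn0 : Qn ≠ 0 := by rintro rfl; simp at hsgn
          -- the roundoff `q` points from `Qn` towards zero (else so would not the lower sum)
          have hqQn : q * Qn < 0 := by
            by_contra hge
            rw [not_lt] at hge
            rcases lt_or_gt_of_ne hQn0 with hneg | hpos
            · have hq0 : q ≤ 0 := by
                by_contra h; rw [not_le] at h; linarith [mul_neg_of_pos_of_neg h hneg]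
              have hlt0 : q + xs.sum < 0 := by
                rw [abs_of_nonpos hq0] at h2s_le_q; linarith [le_abs_self xs.sum]
              linarith [mul_pos_of_neg_of_neg hneg hlt0]
            · have hq0 : 0 ≤ q := by
                by_contra h; rw [not_le] at h; linarith [mul_neg_of_neg_of_pos h hpos]
              have hgt0 : 0 < q + xs.sum := by
                rw [abs_of_nonneg hq0] at h2s_le_q; linarith [neg_abs_le xs.sum]
              linarith [mul_pos hpos hgt0]
          -- hence `Q + x = Qn + q` is closer to zero than `Qn`
          have hulpQn : ulp p emin Qn ≤ |Qn| := ulp_le_abs_of_isFloat hF12.1 hQn0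
          have hlt : |Q + x| < |fl (Q + x)| := by
            rw [← h1, ← h4]
            rcases lt_or_gt_of_ne hQn0 with hneg | hpos
            · have hqpos : 0 < q := by
                by_contra h; rw [not_lt] at h
                linarith [mul_nonneg_of_nonpos_of_nonpos h hneg.le]
              rw [abs_of_neg hneg] at hulpQn
              rw [abs_of_pos hqpos] at hq_half
              rw [abs_of_neg hneg, abs_of_nonpos (by linarith : Qn + q ≤ 0)]
              linarith
            · have hqneg : q < 0 := by
                by_contra h; rw [not_lt] at h
                linarith [mul_nonneg h hpos.le]
              rw [abs_of_pos hpos] at hulpQn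
              rw [abs_of_neg hqneg] at hq_half
              rw [abs_of_pos hpos, abs_of_nonneg (by linarith : 0 ≤ Qn + q)]
              linarith
          -- so `q` is at most a quarter ulp, and `xs` sums to less than `q`
          obtain ⟨j, hj, hpowj⟩ := hpow
          have hquart : |q| ≤ ulp p emin Qn / 4 := by
            have := roundoff_quarter hp1 hfl (Q + x) hj (by rw [← h1]; exact hpowj) hlt
            rwa [← h2, ← h1] at this
          calc |q + xs.sum| ≤ |q| + |xs.sum| := abs_add_le _ _
            _ < |q| + (2 : ℚ) ^ s := by linarith
            _ ≤ |q| + |q| := by linarith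
            _ ≤ ulp p emin Qn / 2 := by linarith


end Summit.Ventures.CertifiedArithmetic.Expansions
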